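import Mathlib
import Summits.CriticalPhenomena.PercolationContinuityZ3.Theorems.PercNearOneGluingNoHeavyLowerTailTypedSectioning
import Summits.CriticalPhenomena.PercolationContinuityZ3.Theorems.PercNearOneGluingNoHeavyLowerTailMSSharp

/-!
# The quantifier-game count of a set family, game domination, and K♯ from domination of the debtor game (hp-7 gen 83)

Helper file for crux `stmt-CriticalPhenomena-4575` (`NoHeavyLowerTail`, route `PercNearOneGluingNoHeavy`), hull-port seat
`prim-hp-7` (generation 83); `--supports stmt-CriticalPhenomena-4575`.  Pure finite set theory; everything is PROVED.
Memo: `run/shared/lean/prim/prim-hp-7/FROM-prim-hp-7-g83-GAME-COUNT.md`.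

**The counting identity.**  Process the coordinates of a list `l` one after the other; at each coordinate `r` a family
`X` of subsets has the *projected* child `proj X r = {S.erase r}` and the *doubled* child `dbl X r = {S ∌ r : insert r S ∈ X}`
(`TypedSectioning.proj/dbl`, hp-7 gen 81), and `#X = #(dbl X r) + #(proj X r)`.  Iterating over all of `l` and ending with
`[∅ ∈ ·]` gives `gameCount l X`, the number of words `w ∈ {proj, dbl}^l` whose iterated child contains `∅` — equivalently the
number of quantifier prefixes `Q_{r_m} ⋯ Q_{r_1}` (`∃` for proj, `∀` for dbl; the first processed coordinate innermost) under which
the ∃-player can force the played set into `X`.  **`card_eq_gameCount`: `#X = gameCount l X`** whenever every member of `X` lies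
inside `l`.  Consequently (**`card_le_card_of_dominates`**) if `Y` wins every quantifier game that `X` wins (`Dominates l X Y`,
defined by the same recursion), then `#X ≤ #Y` — no injection and no sectioning certificate is needed.

**K♯ from game domination.**  For monotone labellings `g h : Finset α → Lab 3` let `debtors g h` be the debtor sets
(`GeneratedDonors.debtors`, hp-7 g64) and `resolved g h` the sets `q` with `q` or `univ \ q` an ANTI-DONOR (complement good, own
support empty).  Resolved sets are credited and uncharged, so **`kSharp_ineq_of_card_debtors_le_card_resolved`**:
`#debtors ≤ #resolved` already gives the K♯ inequality `#charged ≤ #{q : q good ∨ qᶜ good}`; and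
**`kSharp_ineq_of_dominates`**: it suffices that, for ONE processing order `l` of all coordinates, the resolved family dominates the
debtor family in every quantifier game.  This is the gen-83 reduction of Conjecture K♯ to the *debtor-game domination* statement
(memo §1; verified for all 30 046 920 monotone maps `2^[4] → 𝓗` in some order, and in EVERY order for all vertex-labelled ones).
-/

namespace Summit.CriticalPhenomena.PercolationContinuityZ3.Theorems

namespace GameCount

open Finset TypedSectioning

variable {α : Type*} [DecidableEq α]

/-- The quantifier-game count of a family along the processing list `l`: split at the head coordinate into the doubled and the
projected child and recurse; at the end count `1` if the empty set survived. -/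
def gameCount : List α → Finset (Finset α) → ℕ
  | [], X => if (∅ : Finset α) ∈ X then 1 else 0
  | r :: l, X => gameCount l (dbl X r) + gameCount l (proj X r)

/-- `Y` dominates `X` along `l`: every quantifier game (word over `l`) won by `X` is won by `Y` — stated by the same recursion:
at the end `∅ ∈ X → ∅ ∈ Y`, and at each coordinate both children of `Y` dominate the corresponding children of `X`. -/
def Dominates : List α → Finset (Finset α) → Finset (Finset α) → Prop
  | [], X, Y => (∅ : Finset α) ∈ X → (∅ : Finset α) ∈ Y
  | r :: l, X, Y => Dominates l (dbl X r) (dbl Y r) ∧ Dominates l (proj X r) (proj Y r)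

/-- Members of the doubled child lie inside the remaining coordinates. -/
theorem subset_of_mem_dbl {X : Finset (Finset α)} {r : α} {l : List α}
    (hX : ∀ S ∈ X, S ⊆ (r :: l).toFinset) {S : Finset α} (hS : S ∈ dbl X r) : S ⊆ l.toFinset := by
  rw [mem_dbl] at hS
  intro x hx
  have hx' := hX S hS.1 hx
  rw [List.toFinset_cons, mem_insert] at hx'
  rcases hx' with rfl | h
  · exact absurd hx hS.2.1
  · exact h

/-- Members of the projected child lie inside the remaining coordinates. -/
theorem subset_of_mem_proj {X : Finset (Finset α)} {r : α} {l : List α}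
    (hX : ∀ S ∈ X, S ⊆ (r :: l).toFinset) {S : Finset α} (hS : S ∈ proj X r) : S ⊆ l.toFinset := by
  rw [mem_proj] at hS
  obtain ⟨T, hT, rfl⟩ := hS
  intro x hx
  rw [mem_erase] at hx
  have hx' := hX T hT hx.2
  rw [List.toFinset_cons, mem_insert] at hx'
  rcases hx' with h | h
  · exact absurd h hx.1
  · exact h

/-- **The counting identity** (hp-7 gen 83): a family of subsets of the coordinates of `l` has exactly `gameCount l X` members —
the number of quantifier words under which the ∃-player forces the played set into `X`. -/
theorem card_eq_gameCount (l : List α) (X : Finset (Finset α)) (hX : ∀ S ∈ X, S ⊆ l.toFinset) :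
    #X = gameCount l X := by
  induction l generalizing X with
  | nil =>
    have hsub : X ⊆ {∅} := by
      intro S hS
      rw [mem_singleton]
      exact subset_empty.mp (by simpa using hX S hS)
    unfold gameCount
    by_cases h : (∅ : Finset α) ∈ X
    · rw [if_pos h]
      have : X = {∅} := subset_antisymm hsub (singleton_subset_iff.mpr h)
      rw [this, card_singleton]
    · rw [if_neg h]
      have : X = ∅ := by
        apply eq_empty_of_forall_notMem
        intro S hS
        have := hsub hS
        rw [mem_singleton] at this
        exact h (this ▸ hS)
      rw [this, card_empty]
  | cons r l ih =>
    unfold gameCount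
    rw [card_eq_card_dbl_add_card_proj X r, ih (dbl X r) (fun S hS => subset_of_mem_dbl hX hS),
      ih (proj X r) (fun S hS => subset_of_mem_proj hX hS)]

/-- Domination is monotone for the game count. -/
theorem gameCount_le_of_dominates {l : List α} {X Y : Finset (Finset α)} (h : Dominates l X Y) :
    gameCount l X ≤ gameCount l Y := by
  induction l generalizing X Y with
  | nil =>
    unfold Dominates at h
    unfold gameCount
    by_cases hx : (∅ : Finset α) ∈ X
    · rw [if_pos hx, if_pos (h hx)]
    · rw [if_neg hx]; exact Nat.zero_le _
  | cons r l ih =>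
    unfold Dominates at h
    unfold gameCount
    exact Nat.add_le_add (ih h.1) (ih h.2)

/-- **Game domination bounds the cardinality** (hp-7 gen 83): if every member of `X` and of `Y` lies inside the coordinates of `l`
and `Y` dominates `X` in every quantifier game along `l`, then `#X ≤ #Y`. -/
theorem card_le_card_of_dominates (l : List α) {X Y : Finset (Finset α)}
    (hX : ∀ S ∈ X, S ⊆ l.toFinset) (hY : ∀ S ∈ Y, S ⊆ l.toFinset) (h : Dominates l X Y) : #X ≤ #Y := by
  rw [card_eq_gameCount l X hX, card_eq_gameCount l Y hY]
  exact gameCount_le_of_dominates h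

/-- Domination is reflexive. -/
theorem dominates_refl (l : List α) (X : Finset (Finset α)) : Dominates l X X := by
  induction l generalizing X with
  | nil => unfold Dominates; exact id
  | cons r l ih => unfold Dominates; exact ⟨ih _, ih _⟩

/-- The doubled child is monotone in the family. -/
theorem dbl_mono {X Y : Finset (Finset α)} (h : X ⊆ Y) (r : α) : dbl X r ⊆ dbl Y r := by
  intro S hS
  rw [mem_dbl] at hS ⊢
  exact ⟨h hS.1, hS.2.1, h hS.2.2⟩

/-- The projected child is monotone in the family. -/
theorem proj_mono {X Y : Finset (Finset α)} (h : X ⊆ Y) (r : α) : proj X r ⊆ proj Y r := by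
  intro S hS
  rw [mem_proj] at hS ⊢
  obtain ⟨T, hT, hTS⟩ := hS
  exact ⟨T, h hT, hTS⟩

/-- A larger family dominates a smaller one. -/
theorem dominates_of_subset (l : List α) {X Y : Finset (Finset α)} (h : X ⊆ Y) : Dominates l X Y := by
  induction l generalizing X Y with
  | nil => unfold Dominates; exact fun hx => h hx
  | cons r l ih => unfold Dominates; exact ⟨ih (dbl_mono h r), ih (proj_mono h r)⟩

/-- Domination is transitive. -/
theorem dominates_trans {l : List α} {X Y Z : Finset (Finset α)} (h₁ : Dominates l X Y) (h₂ : Dominates l Y Z) :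
    Dominates l X Z := by
  induction l generalizing X Y Z with
  | nil => unfold Dominates at h₁ h₂ ⊢; exact fun hx => h₂ (h₁ hx)
  | cons r l ih => unfold Dominates at h₁ h₂ ⊢; exact ⟨ih h₁.1 h₂.1, ih h₁.2 h₂.2⟩

end GameCount

/-! ### K♯ from domination of the debtor game by the resolved sets -/

namespace GeneratedDonors

open Finset OrientedAntipodalHall AntipodalStrongHarris AntipodalStrongHarris.Lab GameCount

variable {α : Type} [Fintype α] [DecidableEq α]

/-- `d` is an ANTI-DONOR for `(g, h)`: its complement is good (`g dᶜ = A`, `h d = B`) and its own support is empty.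
(By Lemma A every generated difference is an anti-donor; anti-donors form a down-set for monotone `g, h`.) -/
def IsAntiDonor (g h : Finset α → Lab 3) (d : Finset α) : Prop :=
  g (univ \ d) = top ∧ h d = bot ∧ ∀ a b : Fin 3, ¬ InSupp (g d) (h (univ \ d)) a b

/-- Being an anti-donor is decidable. -/
instance (g h : Finset α → Lab 3) (d : Finset α) : Decidable (IsAntiDonor g h d) := by
  unfold IsAntiDonor; infer_instance

/-- The RESOLVED sets: `q` or its complement is an anti-donor (equivalently `{c q, c qᶜ} = {⊥, ⊤}` in hexagon language). -/
def resolved (g h : Finset α → Lab 3) : Finset (Finset α) :=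
  {q ∈ (univ : Finset (Finset α)) | IsAntiDonor g h q ∨ IsAntiDonor g h (univ \ q)}

/-- **K♯ from counting resolved sets** (hp-7 gen 83): if the debtor sets are at most as numerous as the resolved sets, then
the K♯ inequality `#charged ≤ #{q : q good ∨ qᶜ good}` holds at `(g, h)`.  (Resolved sets are credited and uncharged; debtors are
exactly the charged uncredited sets.)  No monotonicity is needed for this accounting step. -/
theorem kSharp_ineq_of_card_debtors_le_card_resolved (g h : Finset α → Lab 3)
    (hle : #(debtors g h) ≤ #(resolved g h)) :
    #{q ∈ (univ : Finset (Finset α)) | IsCharged 3 g h q} ≤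
      #{q ∈ (univ : Finset (Finset α)) | (g q = top ∧ h (univ \ q) = bot) ∨ (g (univ \ q) = top ∧ h q = bot)} := by
  classical
  have hcc : ∀ q : Finset α, univ \ (univ \ q) = q := fun q => by
    rw [Finset.sdiff_sdiff_eq_self (subset_univ q)]
  set Ch : Finset (Finset α) := {q ∈ (univ : Finset (Finset α)) | IsCharged 3 g h q} with hCh
  set Cr : Finset (Finset α) := {q ∈ (univ : Finset (Finset α)) |
    (g q = top ∧ h (univ \ q) = bot) ∨ (g (univ \ q) = top ∧ h q = bot)} with hCr
  have hmemCh : ∀ q, q ∈ Ch ↔ IsCharged 3 g h q := fun q => by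
    rw [hCh, mem_filter]; simp only [mem_univ, true_and]
  have hmemCr : ∀ q, q ∈ Cr ↔ Credited g h q := fun q => by
    rw [hCr, mem_filter]; unfold Credited; simp only [mem_univ, true_and]
  have hchsymm : ∀ q, IsCharged 3 g h q → IsCharged 3 g h (univ \ q) := by
    rintro q ⟨a, b, hab, h1, h2, h3, h4⟩
    exact ⟨b, a, hab.symm, h3, h4, by rw [hcc]; exact h1, by rw [hcc]; exact h2⟩
  -- resolved ⊆ credited \ charged
  have hres : resolved g h ⊆ Cr \ Ch := by
    intro q hq
    unfold resolved at hq
    rw [mem_filter] at hq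
    rw [mem_sdiff, hmemCr, hmemCh]
    rcases hq.2 with ⟨h1, h2, h3⟩ | ⟨h1, h2, h3⟩
    · exact ⟨Or.inr ⟨h1, h2⟩, not_isCharged_of_supp_empty h3⟩
    · refine ⟨Or.inl ⟨by rw [hcc] at h1; exact h1, h2⟩, fun hc => not_isCharged_of_supp_empty h3 (hchsymm q hc)⟩
  -- debtors = charged \ credited
  have hDeb : debtors g h = Ch \ Cr := by
    ext q
    unfold debtors
    rw [mem_filter, mem_sdiff, hmemCh, hmemCr]
    simp only [mem_univ, true_and]
  have h1 : #(Ch \ Cr) ≤ #(Cr \ Ch) := by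
    rw [← hDeb]; exact hle.trans (card_le_card hres)
  have h2 := card_sdiff_add_card_inter Ch Cr
  have h3 := card_sdiff_add_card_inter Cr Ch
  rw [inter_comm] at h3
  omega

/-- Every debtor set and every resolved set is a subset of the coordinates of a list enumerating `univ`. -/
theorem subset_toFinset_of_univ (l : List α) (hl : l.toFinset = univ) (S : Finset α) : S ⊆ l.toFinset := by
  rw [hl]; exact subset_univ S

/-- **K♯ from debtor-game domination** (hp-7 gen 83).  If for some processing order `l` of all coordinates the resolved family
dominates the debtor family in every quantifier game (`GameCount.Dominates`), then the K♯ inequality holds at `(g, h)`: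
by the counting identity `#debtors ≤ #resolved`, and resolved sets are credited and uncharged. -/
theorem kSharp_ineq_of_dominates (g h : Finset α → Lab 3) (l : List α) (hl : l.toFinset = univ)
    (hdom : Dominates l (debtors g h) (resolved g h)) :
    #{q ∈ (univ : Finset (Finset α)) | IsCharged 3 g h q} ≤
      #{q ∈ (univ : Finset (Finset α)) | (g q = top ∧ h (univ \ q) = bot) ∨ (g (univ \ q) = top ∧ h q = bot)} :=
  kSharp_ineq_of_card_debtors_le_card_resolved g h
    (card_le_card_of_dominates l (fun S _ => subset_toFinset_of_univ l hl S)
      (fun S _ => subset_toFinset_of_univ l hl S) hdom)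

/-- The generated differences are resolved (Lemma A): for monotone `g, h`, `genSharp g h ⊆ resolved g h`. -/
theorem genSharp_subset_resolved (g h : Finset α → Lab 3)
    (hg : ∀ ⦃X Y : Finset α⦄, X ⊆ Y → g X ≤ g Y) (hh : ∀ ⦃X Y : Finset α⦄, X ⊆ Y → h X ≤ h Y) :
    genSharp g h ⊆ resolved g h := by
  intro d hd
  obtain ⟨q, -, s, -, hl, rfl⟩ := mem_genSharp.mp hd
  unfold resolved
  rw [mem_filter]
  exact ⟨mem_univ _, Or.inl (good_compl_and_null_of_close hg hh hl)⟩

/-- Anti-donors form a DOWN-SET for monotone labellings: a subset of an anti-donor is an anti-donor. -/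
theorem isAntiDonor_of_subset (g h : Finset α → Lab 3)
    (hg : ∀ ⦃X Y : Finset α⦄, X ⊆ Y → g X ≤ g Y) (hh : ∀ ⦃X Y : Finset α⦄, X ⊆ Y → h X ≤ h Y)
    {d d' : Finset α} (hdd : d' ⊆ d) (hd : IsAntiDonor g h d) : IsAntiDonor g h d' := by
  obtain ⟨h1, h2, h3⟩ := hd
  have hc : univ \ d ⊆ univ \ d' := sdiff_subset_sdiff (subset_refl _) hdd
  refine ⟨?_, ?_, fun a b hab => h3 a b (inSupp_mono hg hh hdd hab)⟩
  · have := hg hc; rw [h1] at this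
    rw [le_def] at this
    rcases this with h' | h' | h'
    · cases h'
    · exact h'
    · exact h'.symm
  · have := hh hdd; rw [h2] at this
    rw [le_def] at this
    rcases this with h' | h' | h'
    · exact h'
    · cases h'
    · exact h'

/-- **Conjecture K♯ follows from debtor-game domination** (hp-7 gen 83 reduction): if for every pair of monotone labellings some
processing order of the coordinates makes the resolved family dominate the debtor family in every quantifier game, then `KSharp 3`
(hence Conjecture K, FS′, FS).  The hypothesis is the gen-83 *debtor-game conjecture* (memo §1), verified for all monotone maps on
`2^[4]` and on large samples for `n ≤ 6`. -/
theorem kSharp_of_debtorGameDomination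
    (H : ∀ (α : Type) [Fintype α] [DecidableEq α] (g h : Finset α → Lab 3),
      (∀ ⦃X Y : Finset α⦄, X ⊆ Y → g X ≤ g Y) → (∀ ⦃X Y : Finset α⦄, X ⊆ Y → h X ≤ h Y) →
        ∃ l : List α, l.toFinset = univ ∧ Dominates l (debtors g h) (resolved g h)) :
    KSharp 3 := by
  intro α _ _ g h hg hh
  obtain ⟨l, hl, hdom⟩ := H α g h hg hh
  exact kSharp_ineq_of_dominates g h l hl hdom

end GeneratedDonors

end Summit.CriticalPhenomena.PercolationContinuityZ3.Theorems
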